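import Summits.PneNP.PneNP.Theses.KrwChromaticSteering

/-!
# Route KrwChromaticSteering, crux `StrongComposition` (stmt-PneNP-18538) — the registered skeleton's objects

Definitions file for the crux C1 `Summit.PneNP.PneNP.Theses.KrwChromaticSteering.StrongComposition`
(strong composition with `γ = 1`: `∃ c, ∀ m n, 1 ≤ n → ∀ f` non-constant `∃ g, ∀ P : KWTree (Fin m × Fin n),
P.SolvesStrong f g → ∃ Q : KWTree (Fin m), Q.Solves f ∧ Q.depth + n ≤ P.depth + c * (Nat.log 2 (m * n) + 1)`).

The registered birth skeleton `Summits/PneNP/PneNP/Cruxes/StrongComposition/Lines/birth.lean`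
(planner-skel-stmt-PneNP-18538, sha d043782a…; line: Meir 2023, arXiv:2306.00615, §3–4 with `γ`
raised to `1` by steering) is a crux workfile (sorried stubs) and not an importable module; this file
carries its OBJECTS VERBATIM so that the stub files can share them:

* per-player consistency of an input with a bit string read along a standard protocol tree
  (`AliceConsistent`, `BobConsistent` — structural descent: at an own node the sent bit must match the
  next bit of `π`, at the other player's node any bit is received, past a leaf everything is consistent);
* families of strong-game protocols `Family m n` (one tree for `KW_f ⊛ KW_g` per inner function `g`, the
  data of Meir's Lemma-6 protocol for `KW_f ⊛ MUX_n`) and Meir's Notation-3 objects `Xset` (`𝒳_π(g)`),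
  `Yset` (`𝒴_π(g)`), `Aset` (`𝒜_π(g)`), `Bset` (`ℬ_π(g)`), `Alive` (`𝒱_π`), the weak intersection
  property `WIP` and the characteristic graph `charGraph` (Def. 22) with `chi = χ(G_π)` as a natural
  number, and `SolvesOn` (a `KW_f`-type tree solves the Karchmer–Wigderson game on a rectangle `A × B`);
* the three stub STATEMENTS `ResidualRectangle`, `ChromaticEndgame`, `SteeredTranscript`;
* the skeleton's sorry-free composition `strongComposition_of_sigs` (the three statements imply the
  crux BODY) and `strongComposition_of_stubs`, concluding the crux BY NAME from the three statements.

No stub is proved here (the stub files `…StrongCompositionResidualRectangle.lean`,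
`…StrongCompositionChromaticEndgame.lean` import this module); `SteeredTranscript` is the line's open
LEVER (crux-equivalent given the other two, `Cruxes/StrongComposition/Disproof.lean`).  Honest framing:
C1 is Meir's open problem (strong composition with `γ = 1`); nothing in this file bears on P vs NP.
-/

set_option linter.dupNamespace false -- `Summit.PneNP.PneNP.…`: summit = sub-problem name (D-0017 single-conjunct layout)
set_option autoImplicit false

namespace Summit.PneNP.PneNP.Theorems.KrwStrongComposition

open Literature.Computability.Complexity

universe u

/-! ### Per-player consistency of an input with a bit string, read along a standard tree -/

section Transcripts

variable {ι : Type u}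

/-- `AliceConsistent P x π`: reading the bit string `π` down the tree `P`, at every ALICE node met
the bit Alice would send on input `x` is the next bit of `π` (at Bob nodes she receives whatever
`π` says; once a leaf is reached the rest of `π` is unconstrained).  This is Meir's "the input
`(g_A, X)` is consistent with `π`" (Def. 17 / Notation 2) for the Lemma-6 protocol of a family,
read on Alice's own tree `F g_A`.  VERBATIM the registered skeleton's `AliceConsistent`.
[cite: Meir2023, Def. 17, Notation 2–3] -/
def AliceConsistent : KWTree ι → (ι → Bool) → List Bool → Prop
  | _, _, [] => True
  | KWTree.leaf _, _, _ :: _ => True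
  | KWTree.alice s P _, x, false :: π => s x = false ∧ AliceConsistent P x π
  | KWTree.alice s _ Q, x, true :: π => s x = true ∧ AliceConsistent Q x π
  | KWTree.bob _ P _, x, false :: π => AliceConsistent P x π
  | KWTree.bob _ _ Q, x, true :: π => AliceConsistent Q x π

/-- `BobConsistent P y π`: the same for Bob — at every BOB node met along `π` the bit Bob would
send on input `y` is the next bit of `π`.  VERBATIM the registered skeleton's `BobConsistent`.
[cite: Meir2023, Def. 17, Notation 2–3] -/
def BobConsistent : KWTree ι → (ι → Bool) → List Bool → Prop
  | _, _, [] => True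
  | KWTree.leaf _, _, _ :: _ => True
  | KWTree.alice _ P _, y, false :: π => BobConsistent P y π
  | KWTree.alice _ _ Q, y, true :: π => BobConsistent Q y π
  | KWTree.bob s P _, y, false :: π => s y = false ∧ BobConsistent P y π
  | KWTree.bob s _ Q, y, true :: π => s y = true ∧ BobConsistent Q y π

end Transcripts

/-! ### Families of strong-game protocols and Meir's transcript objects -/

section Family

/-- A FAMILY of standard protocols for the strong games `KW_f ⊛ KW_g`, one tree per inner function
`g` — the data of Meir's Lemma-6 protocol for `KW_f ⊛ MUX_n`.  VERBATIM the skeleton's `Family`.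
[cite: Meir2023, Lemma 6 (§3.1)] -/
abbrev Family (m n : ℕ) : Type := ((Fin n → Bool) → Bool) → KWTree (Fin m × Fin n)

variable {m n : ℕ}

/-- `𝒳_π(g)`: Alice's matrices `X ∈ (f ⋄ g)⁻¹(1)` consistent with `π` along `F g`.  VERBATIM the
skeleton's `Xset`. [cite: Meir2023, Notation 3] -/
def Xset (f : (Fin m → Bool) → Bool) (F : Family m n) (π : List Bool) (g : (Fin n → Bool) → Bool) :
    Set (Fin m × Fin n → Bool) :=
  {X | blockComp f g X = true ∧ AliceConsistent (F g) X π}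

/-- `𝒴_π(g)`: Bob's matrices `Y ∈ (f ⋄ g)⁻¹(0)` consistent with `π` along `F g`.  VERBATIM the
skeleton's `Yset`. [cite: Meir2023, Notation 3] -/
def Yset (f : (Fin m → Bool) → Bool) (F : Family m n) (π : List Bool) (g : (Fin n → Bool) → Bool) :
    Set (Fin m × Fin n → Bool) :=
  {Y | blockComp f g Y = false ∧ BobConsistent (F g) Y π}

/-- `𝒜_π(g) ⊆ f⁻¹(1)`: the label columns `g(X)` of the matrices in `𝒳_π(g)`.  VERBATIM the skeleton's
`Aset`. [cite: Meir2023, Notation 3] -/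
def Aset (f : (Fin m → Bool) → Bool) (F : Family m n) (π : List Bool) (g : (Fin n → Bool) → Bool) :
    Set (Fin m → Bool) :=
  rowLabels g '' Xset f F π g

/-- `ℬ_π(g) ⊆ f⁻¹(0)`: the label columns `g(Y)` of the matrices in `𝒴_π(g)`.  VERBATIM the skeleton's
`Bset`. [cite: Meir2023, Notation 3] -/
def Bset (f : (Fin m → Bool) → Bool) (F : Family m n) (π : List Bool) (g : (Fin n → Bool) → Bool) :
    Set (Fin m → Bool) :=
  rowLabels g '' Yset f F π g

/-- `𝒱_π`: the LIVE inner functions at `π` — both label sides non-empty.  VERBATIM the skeleton's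
`Alive`. [cite: Meir2023, Notation 3] -/
def Alive (f : (Fin m → Bool) → Bool) (F : Family m n) (π : List Bool) : Set ((Fin n → Bool) → Bool) :=
  {g | (Aset f F π g).Nonempty ∧ (Bset f F π g).Nonempty}

/-- The WEAK INTERSECTION PROPERTY of `(g_A, g_B)` at `π`: some `X ∈ 𝒳_π(g_A)`, `Y ∈ 𝒴_π(g_B)` agree
on every row whose labels `a_i = g_A(X_i)`, `b_i = g_B(Y_i)` differ.  VERBATIM the skeleton's `WIP`.
[cite: Meir2023, Def. 22] -/
def WIP (f : (Fin m → Bool) → Bool) (F : Family m n) (π : List Bool)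
    (gA gB : (Fin n → Bool) → Bool) : Prop :=
  ∃ X ∈ Xset f F π gA, ∃ Y ∈ Yset f F π gB,
    ∀ i : Fin m, rowLabels gA X i ≠ rowLabels gB Y i → row X i = row Y i

/-- Meir's CHARACTERISTIC GRAPH `G_π` of the strong multiplexor game, on the type of ALL inner
functions: two distinct functions are adjacent iff the weak intersection property holds in one of
the two orders.  (Meir takes the induced subgraph on the live functions `𝒱_π`; dropping that
restriction can only RAISE `χ`, and Lemma 8's covering argument never uses liveness.)  VERBATIM the
skeleton's `charGraph`. [cite: Meir2023, Def. 22] -/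
def charGraph (f : (Fin m → Bool) → Bool) (F : Family m n) (π : List Bool) :
    SimpleGraph ((Fin n → Bool) → Bool) where
  Adj gA gB := gA ≠ gB ∧ (WIP f F π gA gB ∨ WIP f F π gB gA)
  symm := ⟨fun _ _ h => ⟨fun h' => h.1 h'.symm, h.2.symm⟩⟩
  loopless := ⟨fun _ h => h.1 rfl⟩

/-- `χ(G_π)` as a natural number (the vertex type is finite, so the chromatic number is finite and
`≥ 1`).  VERBATIM the skeleton's `chi`. [cite: Meir2023, Lemma 8] -/
noncomputable def chi (f : (Fin m → Bool) → Bool) (F : Family m n) (π : List Bool) : ℕ :=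
  (charGraph f F π).chromaticNumber.toNat

/-- `SolvesOn Q A B`: the `KW_f`-type tree `Q` solves the Karchmer–Wigderson game on the rectangle
`A × B` (outputs a differing coordinate on every `a ∈ A`, `b ∈ B`); `C(A × B)` is the least depth of
such a tree.  VERBATIM the skeleton's `SolvesOn`.
[cite: Meir2023, §2.3 (KW relations of rectangles, `KW_{A×B}`)] -/
def SolvesOn (Q : KWTree (Fin m)) (A B : Set (Fin m → Bool)) : Prop :=
  ∀ a ∈ A, ∀ b ∈ B, a (Q.run a b) ≠ b (Q.run a b)

end Family

/-! ### The three stub statements (verbatim) -/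

/-- Statement of the registered stub `stub_residualRectangle` (M): at any bit string `π` the residual
protocol of `F g` solves `KW_f` on the live label rectangle `𝒜_π(g) × ℬ_π(g)` within the remaining
depth.  VERBATIM the skeleton's `ResidualRectangle` (Meir 2023 §3.3, hard-wiring `g`). -/
def ResidualRectangle : Prop :=
  ∀ (m n : ℕ) (f : (Fin m → Bool) → Bool) (F : Family m n) (d : ℕ) (π : List Bool)
    (g : (Fin n → Bool) → Bool),
    (F g).SolvesStrong f g → (F g).depth ≤ d → π.length ≤ d →
      ∃ R : KWTree (Fin m), SolvesOn R (Aset f F π g) (Bset f F π g) ∧ π.length + R.depth ≤ d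

/-- Statement of the registered stub `stub_chromaticEndgame` (L): Meir's Lemma 8 in family form,
`|π| + log₂ log₂ χ(G_π) ≤ d + c·(log₂(mn)+1)`.  VERBATIM the skeleton's `ChromaticEndgame`
(Meir 2023 Lemma 8, §4.2). -/
def ChromaticEndgame : Prop :=
  ∃ c : ℕ, ∀ (m n : ℕ) (f : (Fin m → Bool) → Bool) (F : Family m n) (d : ℕ) (π : List Bool),
    (∀ g, (F g).SolvesStrong f g) → (∀ g, (F g).depth ≤ d) → π.length ≤ d →
      π.length + Nat.log 2 (Nat.log 2 (chi f F π)) ≤ d + c * (Nat.log 2 (m * n) + 1)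

/-- Statement of the registered stub `stub_steeredTranscript` (THE LEVER, XL, open): the steered
structure theorem at `γ = 1` in dichotomy form.  VERBATIM the skeleton's `SteeredTranscript`; it is
NOT proved anywhere (it is equivalent to the crux given the two printed stubs). -/
def SteeredTranscript : Prop :=
  ∃ c : ℕ, ∀ (m n : ℕ), 1 ≤ n → ∀ f : (Fin m → Bool) → Bool, (∃ a b, f a ≠ f b) →
    ∀ (F : Family m n) (d : ℕ), (∀ g, (F g).SolvesStrong f g) → (∀ g, (F g).depth ≤ d) →
      ∃ π : List Bool, π.length ≤ d ∧
        ((∃ g ∈ Alive f F π, ∀ R : KWTree (Fin m), SolvesOn R (Aset f F π g) (Bset f F π g) →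
            ∃ Q : KWTree (Fin m), Q.Solves f ∧
              Q.depth + n ≤ π.length + R.depth + c * (Nat.log 2 (m * n) + 1)) ∨
          (∃ Q : KWTree (Fin m), Q.Solves f ∧
              Q.depth + n ≤ π.length + Nat.log 2 (Nat.log 2 (chi f F π)) + c * (Nat.log 2 (m * n) + 1)))

/-! ### Composition (kernel-checked, no sorry, no stub used) -/

/-- COMPOSITION, implication form (VERBATIM the skeleton's `strongComposition_of_sigs`): the three stub
STATEMENTS imply the crux BODY.  By contradiction: if for every `g` some protocol `F g` for
`KW_f ⊛ KW_g` beats every `KW_f` tree by more than `(c₁ + c₂)·L − n`, let `d` be the largest depth in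
the family, attained at `g₀`; the steered transcript's x-branch (with the residual protocol) or
y-branch (with the chromatic endgame) produces a `KW_f` tree `Q` with
`depth Q + n ≤ d + (c₁ + c₂)·L = depth (F g₀) + (c₁ + c₂)·L`, contradicting the choice of `F g₀`. -/
theorem strongComposition_of_sigs (hRR : ResidualRectangle) (hCE : ChromaticEndgame)
    (hST : SteeredTranscript) :
    ∃ c : ℕ, ∀ m n : ℕ, 1 ≤ n → ∀ f : (Fin m → Bool) → Bool, (∃ a b, f a ≠ f b) →
      ∃ g : (Fin n → Bool) → Bool, ∀ P : KWTree (Fin m × Fin n), P.SolvesStrong f g →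
        ∃ Q : KWTree (Fin m), Q.Solves f ∧ Q.depth + n ≤ P.depth + c * (Nat.log 2 (m * n) + 1) := by
  obtain ⟨c₁, hST⟩ := hST
  obtain ⟨c₂, hCE⟩ := hCE
  refine ⟨c₁ + c₂, fun m n hn f hf => ?_⟩
  by_contra hcon
  push Not at hcon
  choose F hF hlt using hcon
  obtain ⟨g₀, -, hg₀⟩ :=
    Finset.exists_max_image (Finset.univ : Finset ((Fin n → Bool) → Bool)) (fun g => (F g).depth)
      Finset.univ_nonempty
  have hdepth : ∀ g, (F g).depth ≤ (F g₀).depth := fun g => hg₀ g (Finset.mem_univ g)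
  have hsplit : (c₁ + c₂) * (Nat.log 2 (m * n) + 1)
      = c₁ * (Nat.log 2 (m * n) + 1) + c₂ * (Nat.log 2 (m * n) + 1) := by
    ring
  have key : ∃ Q : KWTree (Fin m), Q.Solves f ∧
      Q.depth + n ≤ (F g₀).depth + (c₁ + c₂) * (Nat.log 2 (m * n) + 1) := by
    obtain ⟨π, hπ, hcase⟩ := hST m n hn f hf F (F g₀).depth hF hdepth
    rcases hcase with ⟨g, -, hleft⟩ | ⟨Q, hQ, hQd⟩
    · obtain ⟨R, hR, hRd⟩ := hRR m n f F (F g₀).depth π g (hF g) (hdepth g) hπ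
      obtain ⟨Q, hQ, hQd⟩ := hleft R hR
      exact ⟨Q, hQ, by omega⟩
    · have hce := hCE m n f F (F g₀).depth π hF hdepth hπ
      exact ⟨Q, hQ, by omega⟩
  obtain ⟨Q, hQ, hQd⟩ := key
  have hbad := hlt g₀ Q hQ
  omega

/-- THE SKELETON'S ASSEMBLY BY NAME: the three registered stub statements (`stub_residualRectangle :
ResidualRectangle`, `stub_chromaticEndgame : ChromaticEndgame`, `stub_steeredTranscript :
SteeredTranscript`) imply the crux `Summit.PneNP.PneNP.Theses.KrwChromaticSteering.StrongComposition`,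
concluded BY NAME (the route's fq decl, no local shadow).  The lever `SteeredTranscript` is open. -/
theorem strongComposition_of_stubs (hRR : ResidualRectangle) (hCE : ChromaticEndgame)
    (hST : SteeredTranscript) :
    Summit.PneNP.PneNP.Theses.KrwChromaticSteering.StrongComposition :=
  strongComposition_of_sigs hRR hCE hST

end Summit.PneNP.PneNP.Theorems.KrwStrongComposition
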